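import Summits.ResolutionOfSingularities.ResolutionOfSingularities.Theorems.MarkedTransferCampaignW46MohWindowShadePSLaws
import Summits.ResolutionOfSingularities.ResolutionOfSingularities.Theorems.MarkedTransferCampaignW46MohWindowShadeFormalStepCore
import Mathlib.RingTheory.MvPowerSeries.Substitution
import Mathlib.RingTheory.MvPowerSeries.Trunc
import HarnessLib

/-!
# [OURS · L1 W4.6 rung (iii-2), FORMAL ENTRANCE DOOR for POWER-SERIES residuals, brick 0] The series step as an honest substitution,
# `p`-th roots of `p`-th-power-supported series, equimultiplicity from the order, and the `z`-chart factorisation (ring algebra in `K⟦y⟧`)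

Cell `res-hironaka`, LADDER-RESOLUTION rung L (D-0089), slot W4.6 rung (iii); seat res-L1-s46-pv-6 (gen 6). Host route MarkedTransfer,
`--supports stmt-ResolutionOfSingularities-16155 --as helper`; kind proof (no definition).

WHAT. The coefficientwise series step of `…MohWindowShadePSModel` (`Series.step`, `Series.pointTransform`, defined from the polynomial
model on truncations) is identified with the HONEST chart substitution of res-L1-s46-pv-2's dictionary:
* `Series.subst_chartSubst_eq` — `F(u_j, u_j(u_i + τ_i)) = u_j^p · (Series.pointTransform p j b S)` in `K⟦u⟧` (`chartSubst`), for `F` of order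
  `≥ p` (Mathlib's `truncTotal_subst_of_le` + this seat's polynomial identity `…Cleaning.pointTransform_mul_X_pow` + locality);
* `exists_pow_char_eq` — a `p`-th-power-supported series over a perfect field is a `p`-th power; `Series.exists_add_pow_eq_step_F` — the
  series step is the transform plus a constant plus a `p`-th power (the cleaning shear of the formal step);
* `Series.isEquimultiplePoint_of_le_order_add_C`, `Series.constantCoeff_step_F`;
* `exists_subst_rename_eq_X_pow_mul_of_le_order` — under `u_l ↦ z·u_l` a placed `u`-series of order `≥ p` becomes `z^p · m`, `m ∈ 𝔪`
  (the `z`-chart origin is never singular).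
Pure ring algebra; the scheme-level step for series anchors is the next brick. OURS; NOT a statement of the manuscript
[claim: Hironaka2017, status: under-review], nothing of which is used. AI review is weaker than expert review.
References: H. Hauser, Bull. AMS 47 (2010) §§F–G [Hauser2010]; Mathlib `MvPowerSeries.Substitution`/`Trunc`. [folklore]
-/

noncomputable section

set_option linter.dupNamespace false -- mandated namespace of this single-conjunct summit

open IsLocalRing MvPolynomial

namespace Summit.ResolutionOfSingularities.ResolutionOfSingularities.Theorems

namespace CampaignW46

namespace MohWindowShadeFormalInsep

open Literature.AlgebraicGeometry.Resolution
open Literature.AlgebraicGeometry.Resolution.PointBlowup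
open Literature.AlgebraicGeometry.Resolution.Hauser2010
open MohWindowShadePS
open Summit.ResolutionOfSingularities.ResolutionOfSingularities.Theorems.FrobeniusClosing (chartSubst)
open Literature.RingTheory.MvPowerSeries.Jets (mem_maximalIdeal_iff_constantCoeff_eq_zero mem_maximalIdeal_pow_of_le_order)

/-! ## §1 Truncations: this seat's `truncTot` is Mathlib's `truncTotal` -/

section Trunc

variable {σ : Type*} {K : Type*} [Field K] [Fintype σ] [DecidableEq σ]

/-- `truncTot N φ = MvPowerSeries.truncTotal N φ`. [folklore] -/
theorem truncTot_eq_truncTotal (N : ℕ) (φ : MvPowerSeries σ K) : truncTot N φ = MvPowerSeries.truncTotal N φ := by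
  ext e
  rw [coeff_truncTot, MvPowerSeries.coeff_truncTotal_eq_ite]

end Trunc

/-! ## §2 The series transform is the honest chart substitution -/

section Subst

variable {K : Type} [Field K] [DecidableEq K] (p : ℕ) [hp : Fact p.Prime] [CharP K p] {j i : Fin 2}

omit [DecidableEq K] hp [CharP K p] in
/-- The chart substitution of pv-2's dictionary is the model substitution `y_j ↦ y_j`, `y_l ↦ (y_l + b_l)·y_j` of this seat's
`…Cleaning.pointTransform_mul_X_pow` (up to the order of the factors), as polynomials. [folklore] -/
theorem chartSubst_eq_coe (τ : Fin 2 → K) (l : Fin 2) :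
    chartSubst 2 K j τ l = (((fun l : Fin 2 => if l = j then X j else (X l + C (τ l)) * X j) l : MvPolynomial (Fin 2) K) :
      MvPowerSeries (Fin 2) K) := by
  unfold chartSubst
  by_cases hl : l = j
  · simp only [hl, if_true, MvPolynomial.coe_X]
  · simp only [hl, if_false, MvPolynomial.coe_mul, MvPolynomial.coe_add, MvPolynomial.coe_X, MvPolynomial.coe_C]
    ring

omit [DecidableEq K] hp [CharP K p] in
/-- The chart substitution is substitutable (constant coefficients vanish). [folklore] -/
theorem hasSubst_chartSubst (τ : Fin 2 → K) : MvPowerSeries.HasSubst (chartSubst 2 K j τ) :=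
  MvPowerSeries.hasSubst_of_constantCoeff_zero fun l => by
    unfold chartSubst; split_ifs <;> simp

omit [DecidableEq K] hp [CharP K p] in
/-- The constant coefficients of the chart substitution vanish. [folklore] -/
theorem constantCoeff_chartSubst (τ : Fin 2 → K) (l : Fin 2) : MvPowerSeries.constantCoeff (chartSubst 2 K j τ l) = 0 := by
  unfold chartSubst; split_ifs <;> simp

omit [DecidableEq K] hp [CharP K p] in
/-- **[OURS · L1 W4.6] THE SERIES TRANSFORM IS THE HONEST CHART SUBSTITUTION.** For a series state `S` of order `≥ p` (two letters
`j ≠ i`), at the point `b` of the chart `y_j` (`b_j = 0`, `b_i = τ_i`): `F(u_j, u_j(u_i + τ_i)) = u_j^p · (S.pointTransform p j b)` in `K⟦u⟧`.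
Proof: both sides agree coefficientwise with the polynomial identity `…Cleaning.pointTransform_mul_X_pow` applied to a deep truncation
(Mathlib `truncTotal_subst_of_le`, this seat's locality `Series.coeff_pointTransform`). NOT a statement of the manuscript. [folklore] -/
theorem Series.subst_chartSubst_eq (hij : i ≠ j) (htwo : ∀ l, l = j ∨ l = i) (τ b : Fin 2 → K) (hbj : b j = 0) (hbi : b i = τ i)
    (S : Series (Fin 2) K) {o : ℕ} (ho : S.F.order = o) (hpo : p ≤ o) :
    MvPowerSeries.subst (chartSubst 2 K j τ) S.F = MvPowerSeries.X j ^ p * S.pointTransform p j b := by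
  classical
  have hb : ∀ l, b l = if l = j then 0 else τ l := fun l => by
    rcases htwo l with rfl | rfl
    · rw [if_pos rfl, hbj]
    · rw [if_neg hij, hbi]
  set a' : Fin 2 → MvPolynomial (Fin 2) K := fun l => if l = j then X j else (X l + C (b l)) * X j with ha'
  have haa' : ∀ l, chartSubst 2 K j τ l = (a' l : MvPowerSeries (Fin 2) K) := by
    intro l
    rw [chartSubst_eq_coe, ha']
    rcases htwo l with rfl | rfl
    · simp
    · simp only [if_neg hij, hbi]
  ext e
  set k := e.degree + 1 with hk
  -- LHS coefficient through the truncation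
  have h0 : ∀ l, MvPowerSeries.constantCoeff (chartSubst 2 K j τ l) = 0 := constantCoeff_chartSubst τ
  have hL : MvPowerSeries.coeff e (MvPowerSeries.subst (chartSubst 2 K j τ) S.F) =
      MvPolynomial.coeff e (MvPowerSeries.truncTotal k (MvPowerSeries.subst (chartSubst 2 K j τ) S.F)) :=
    (MvPowerSeries.coeff_truncTotal _ (by omega)).symm
  have htr : ∀ l, MvPowerSeries.truncTotal (k + 3) (chartSubst 2 K j τ l) = a' l := by
    intro l
    rw [haa', MvPowerSeries.truncTotal_coe_eq_self_iff _ (by omega)]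
    rw [ha']
    rcases htwo l with rfl | rfl
    · simp only [if_true, MvPolynomial.totalDegree_X]; omega
    · simp only [if_neg hij]
      refine lt_of_le_of_lt (MvPolynomial.totalDegree_mul _ _) ?_
      refine lt_of_le_of_lt (Nat.add_le_add (MvPolynomial.totalDegree_add _ _) (MvPolynomial.totalDegree_X _).le) ?_
      rw [MvPolynomial.totalDegree_X, MvPolynomial.totalDegree_C]
      simp
  rw [hL, MvPowerSeries.truncTotal_subst_of_le h0 (x := fun _ => k + 3) (fun _ => le_self_add)]
  simp only [htr]
  rw [MvPowerSeries.coeff_truncTotal _ (by omega), MvPowerSeries.subst_coe, ← truncTot_eq_truncTotal]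
  -- the inner polynomial substitution is the polynomial identity
  have hcoe : (MvPolynomial.aeval fun l => (a' l : MvPowerSeries (Fin 2) K)) (truncTot k S.F) =
      ((MvPolynomial.aeval a' (truncTot k S.F) : MvPolynomial (Fin 2) K) : MvPowerSeries (Fin 2) K) := by
    have hC : (MvPolynomial.coeToMvPowerSeries.ringHom : MvPolynomial (Fin 2) K →+* MvPowerSeries (Fin 2) K).comp
        (algebraMap K (MvPolynomial (Fin 2) K)) = algebraMap K (MvPowerSeries (Fin 2) K) := by
      ext c
      simp [MvPolynomial.algebraMap_eq, MvPowerSeries.c_eq_algebraMap]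
    rw [← MvPolynomial.coeToMvPowerSeries.ringHom_apply (MvPolynomial.aeval a' (truncTot k S.F)), MvPolynomial.aeval_def,
      MvPolynomial.aeval_def, MvPolynomial.eval₂_comp_left, hC]
    rfl
  have hdeg : ∀ d ∈ (S.trunc k).F.support, p ≤ d.degree := fun d hd =>
    le_trans hpo (S.le_degree_of_order_eq ho d (((agree_trunc k S).mem_support_iff
      (degree_lt_of_mem_support_truncTot hd)).mp hd))
  have hpoly := MohWindowShadeCleaning.pointTransform_mul_X_pow p hij htwo b hbj (S.trunc k) hdeg
  rw [hcoe, MvPolynomial.coeff_coe, show truncTot k S.F = (S.trunc k).F from rfl, ← hpoly]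
  -- compare the two products with `X_j^p` coefficientwise
  rw [MvPolynomial.X_pow_eq_monomial, MvPolynomial.coeff_mul_monomial', MvPowerSeries.X_pow_eq, MvPowerSeries.coeff_monomial_mul]
  by_cases hle : Finsupp.single j p ≤ e
  · rw [if_pos hle, if_pos hle, mul_one, one_mul]
    symm
    refine S.coeff_pointTransform hbj (e - Finsupp.single j p) fun d hd => ((agree_trunc k S).1 d ?_)
    have h1 : (e - Finsupp.single j p) j + p = e j := by
      rw [Finsupp.tsub_apply, Finsupp.single_eq_same]
      have := Finsupp.single_le_iff.mp hle
      omega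
    have h2 := Finsupp.le_degree j e
    omega
  · rw [if_neg hle, if_neg hle]

end Subst

/-! ## §3 `p`-th roots of `p`-th-power-supported series; the cleaning shear of the series step -/

section Roots

variable {σ : Type*} [Fintype σ] [DecidableEq σ] {K : Type*} [Field K] [DecidableEq K] (p : ℕ) [hp : Fact p.Prime] [CharP K p]
  [PerfectRing K p]

omit [DecidableEq σ] [DecidableEq K] in
/-- **A `p`-th-power-supported series over a perfect field is a `p`-th power** (coefficientwise `p`-th roots; Frobenius is additive).
[folklore] -/
theorem exists_pow_char_eq {D : MvPowerSeries σ K} (hD : ∀ d : σ →₀ ℕ, ¬ IsPthPowerExponent p d → MvPowerSeries.coeff d D = 0) :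
    ∃ Q : MvPowerSeries σ K, Q ^ p = D := by
  classical
  refine ⟨fun e => (frobeniusEquiv K p).symm (MvPowerSeries.coeff (p • e) D), ?_⟩
  set Q : MvPowerSeries σ K := fun e => (frobeniusEquiv K p).symm (MvPowerSeries.coeff (p • e) D) with hQ
  ext d
  have hk : d.degree < d.degree + 1 := Nat.lt_succ_self _
  rw [← MvPowerSeries.coeff_truncTotal_pow Q hk, ← pow_one p, pow_char_pow_eq_sum_monomial p 1 (MvPowerSeries.truncTotal _ Q),
    pow_one, MvPolynomial.coeff_sum]
  simp only [MvPolynomial.coeff_monomial]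
  by_cases hPd : IsPthPowerExponent p d
  · -- `d = p • e₀`
    obtain ⟨e₀, he₀⟩ : ∃ e₀ : σ →₀ ℕ, d = p • e₀ := by
      refine ⟨Finsupp.equivFunOnFinite.symm fun l => d l / p, Finsupp.ext fun l => ?_⟩
      rw [Finsupp.smul_apply, Finsupp.coe_equivFunOnFinite_symm, smul_eq_mul,
        Nat.mul_div_cancel' ((isPthPowerExponent_iff p d).mp hPd l)]
    have hinj : ∀ e : σ →₀ ℕ, p • e = d → e = e₀ := by
      intro e he
      ext l
      have := DFunLike.congr_fun (he.trans he₀) l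
      simp only [Finsupp.smul_apply, smul_eq_mul] at this
      exact Nat.eq_of_mul_eq_mul_left hp.out.pos this
    rw [Finset.sum_eq_single e₀]
    · rw [if_pos he₀.symm, MvPowerSeries.coeff_truncTotal, hQ, MvPowerSeries.coeff_apply, ← he₀, ← frobenius_def,
        ← frobeniusEquiv_apply, RingEquiv.apply_symm_apply]
      have h1 := Finsupp.degree_mono (show e₀ ≤ d by
        rw [he₀]; exact Finsupp.le_def.mpr fun l => by simp only [Finsupp.smul_apply, smul_eq_mul]; exact Nat.le_mul_of_pos_left _ hp.out.pos)
      omega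
    · intro e _ hne
      rw [if_neg]
      intro h
      exact hne (hinj e h)
    · intro hmem
      rw [if_pos he₀.symm, MvPolynomial.notMem_support_iff.mp hmem, zero_pow hp.out.ne_zero]
  · rw [hD d hPd]
    refine Finset.sum_eq_zero fun e _ => ?_
    rw [if_neg]
    rintro rfl
    exact hPd fun l _ => by simp

variable {q : ℕ}

omit hp [CharP K p] [PerfectRing K p] in
/-- The constant coefficient of the series step vanishes (constants are `q`-th power monomials). [folklore] -/
theorem Series.constantCoeff_step_F (q : ℕ) (j : σ) (b : σ → K) (S : Series σ K) :
    MvPowerSeries.constantCoeff (S.step q j b).F = 0 := by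
  rw [← MvPowerSeries.coeff_zero_eq_constantCoeff_apply]
  exact S.isClean_step q j b 0 (fun l hl => by simp at hl)

/-- **[OURS · L1 W4.6] The series step is the transform, plus any constant, plus a `p`-th power** (the cleaning shear of the formal step,
series form of `exists_add_pow_eq_deletePthPowers` + `deletePthPowers_add_C`). NOT a statement of the manuscript. [folklore] -/
theorem Series.exists_add_pow_eq_step_F (j : σ) (b : σ → K) (S : Series σ K) (u : K) :
    ∃ Q : MvPowerSeries σ K, S.pointTransform p j b + MvPowerSeries.C u + Q ^ p = (S.step p j b).F := by
  classical
  obtain ⟨Q, hQ⟩ := exists_pow_char_eq p (D := (S.step p j b).F - S.pointTransform p j b - MvPowerSeries.C u) (fun d hd => by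
    rw [map_sub, map_sub, MvPowerSeries.coeff_C, if_neg (by rintro rfl; exact hd fun l hl => by simp at hl), sub_zero, sub_eq_zero,
      MvPowerSeries.coeff_apply, MvPowerSeries.coeff_apply]
    show MvPolynomial.coeff d (deletePthPowers p _) = _
    rw [coeff_deletePthPowers, if_neg hd]
    rfl)
  exact ⟨Q, by rw [hQ]; ring⟩

end Roots

/-! ## §4 Equimultiplicity of a series state from the order of its transform -/

section Equimultiple

variable {σ : Type*} [Fintype σ] [DecidableEq σ] {K : Type*} [Field K] (q : ℕ)

/-- If the transform plus a constant has order `≥ q`, the point is equimultiple (series form of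
`MohWindowShadeAnchorCore.isEquimultiplePoint_of_le_ordZero_add_C`). [folklore] -/
theorem Series.isEquimultiplePoint_of_le_order_add_C {j : σ} {b : σ → K} {S : Series σ K} {u : K}
    (h : (q : ℕ∞) ≤ (S.pointTransform q j b + MvPowerSeries.C u).order) : S.IsEquimultiplePoint q j b := by
  intro d hd0 hdq
  have h1 : MvPowerSeries.coeff d (S.pointTransform q j b + MvPowerSeries.C u) = 0 :=
    MvPowerSeries.coeff_of_lt_order (lt_of_lt_of_le (by exact_mod_cast hdq) h)
  rwa [map_add, MvPowerSeries.coeff_C, if_neg hd0, add_zero] at h1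

end Equimultiple

/-! ## §5 The `z`-chart: a placed `u`-series of order `≥ p` under `u_l ↦ z·u_l` -/

section ZChart

variable {K : Type} [Field K] (p : ℕ)

/-- **Under a substitution with `σ(u_l) = z · u_l`, a placed `u`-series of order `≥ p` goes to `z^p · m` with `m ∈ 𝔪`** (`0 < p`; series
form of `…FormalStepZChart.exists_subst_rename_eq_X_pow_mul`: the image of `𝔪_u^p` under the composite ring map lies in `(z)^p · 𝔪^p`).
[folklore] -/
theorem exists_subst_rename_eq_X_pow_mul_of_le_order {σ' : Option (Fin 2) → MvPowerSeries (Option (Fin 2)) K}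
    (hσsub : MvPowerSeries.HasSubst σ') (hσl : ∀ l : Fin 2, σ' (some l) = MvPowerSeries.X none * MvPowerSeries.X (some l)) (hp0 : 0 < p)
    (F : MvPowerSeries (Fin 2) K) (hF : (p : ℕ∞) ≤ F.order) :
    ∃ m : MvPowerSeries (Option (Fin 2)) K, m ∈ maximalIdeal (MvPowerSeries (Option (Fin 2)) K) ∧
      MvPowerSeries.subst σ' (MvPowerSeries.rename (some : Fin 2 → Option (Fin 2)) F) = MvPowerSeries.X none ^ p * m := by
  set θ : MvPowerSeries (Fin 2) K →+* MvPowerSeries (Option (Fin 2)) K :=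
    (MvPowerSeries.substAlgHom hσsub).toRingHom.comp
      (MvPowerSeries.rename (some : Fin 2 → Option (Fin 2)) : MvPowerSeries (Fin 2) K →ₐ[K] _).toRingHom with hθ
  have hθapp : ∀ f, θ f = MvPowerSeries.subst σ' (MvPowerSeries.rename (some : Fin 2 → Option (Fin 2)) f) := fun f => by
    rw [hθ, RingHom.comp_apply]
    change MvPowerSeries.substAlgHom hσsub (MvPowerSeries.rename some f) = _
    rw [MvPowerSeries.substAlgHom_apply]
  have hθX : ∀ l : Fin 2, θ (MvPowerSeries.X l) = MvPowerSeries.X none * MvPowerSeries.X (some l) := fun l => by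
    rw [hθapp, MvPowerSeries.rename_X, MvPowerSeries.subst_X hσsub, hσl]
  -- `θ(𝔪_u) ≤ (z) · 𝔪`
  have hmap : (maximalIdeal (MvPowerSeries (Fin 2) K)).map θ ≤
      Ideal.span {(MvPowerSeries.X none : MvPowerSeries (Option (Fin 2)) K)} * maximalIdeal (MvPowerSeries (Option (Fin 2)) K) := by
    rw [maximalIdeal_mvPowerSeries_eq_span K (Fin 2), Ideal.map_span, Ideal.span_le]
    rintro _ ⟨_, ⟨l, rfl⟩, rfl⟩
    rw [hθX]
    exact Ideal.mul_mem_mul (Ideal.subset_span rfl)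
      (mem_maximalIdeal_iff_constantCoeff_eq_zero.mpr (MvPowerSeries.constantCoeff_X _))
  have hFmem : F ∈ maximalIdeal (MvPowerSeries (Fin 2) K) ^ p := mem_maximalIdeal_pow_of_le_order hF
  have h1 : θ F ∈ (Ideal.span {(MvPowerSeries.X none : MvPowerSeries (Option (Fin 2)) K)} *
      maximalIdeal (MvPowerSeries (Option (Fin 2)) K)) ^ p := by
    have := Ideal.mem_map_of_mem θ hFmem
    rw [Ideal.map_pow] at this
    exact Ideal.pow_right_mono hmap p this
  rw [mul_pow, Ideal.span_singleton_pow] at h1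
  have h2 : θ F ∈ Ideal.span {(MvPowerSeries.X none : MvPowerSeries (Option (Fin 2)) K) ^ p} *
      maximalIdeal (MvPowerSeries (Option (Fin 2)) K) :=
    Ideal.mul_mono_right (Ideal.pow_le_self hp0.ne') h1
  obtain ⟨m, hm, hmeq⟩ := Ideal.mem_span_singleton_mul.mp h2
  exact ⟨m, hm, by rw [← hθapp, ← hmeq]⟩

end ZChart

end MohWindowShadeFormalInsep

end CampaignW46

end Summit.ResolutionOfSingularities.ResolutionOfSingularities.Theorems

end
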